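import Summits.HubbardSuperconductivity.HubbardSuperconductivity.Theorems.WeakCouplingBCSKlLindhardEnclosureStraddle
import Summits.HubbardSuperconductivity.HubbardSuperconductivity.Theorems.WeakCouplingBCSKlLindhardEnclosureLogBounds

/-!
# KL-MARGIN-SCAN reader (22) «kernel-lindhard-enclosure» — the one-coordinate MAJORISED-HYPERBOLA ceiling: core theorems (variants B and A)

The kernel-data-agnostic core of `Params.ceilBdry`'s variants `vB` (substitute the ORDINATE cosine) and `vA` (substitute the ABSCISSA
cosine): given (H1) strip-wise domination of the two-shell integrand on the closed cell by the crescent majorant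
`cres (!far) (m ·) (Smin/2^40) (Vlo/2^40)` in the cosine of the substituted (possibly shifted) coordinate, (H2) the outer cosine range and
the checked lower sine bound `τ/10⁴` on that coordinate, (H3) crescent extents `≤ LB/2^40`, the cell integral obeys
`2^30 ∫_cell F ≤ cdivZ (2^30 · dz · 10⁴ · logUpZ (cdivZ (Smin·LB) Vlo)) (U · τ · Smin)` — literally the kernel's `vB`/`vA` numerator
(`…Crescent.strip_lemma` + `…LogBounds.le_logUpZ` + outward integer rounding).  Also: the cell integral as an iterated integral over CLOSED
coordinate intervals in either order, integrability of the integrand on such a cell.  Honest framing: nothing in this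
file asserts a KL margin at any `t′ ≠ 0`, `K₃`, `U₀`, the window or B1g dominance; a Kohn–Luttinger instability statement is not ODLRO and
nothing here proves superconductivity in the Hubbard model.  (p1 g26, 2026-08-29.)
-/

noncomputable section

set_option linter.dupNamespace false

namespace Summit.HubbardSuperconductivity.HubbardSuperconductivity.Theorems.KlLindhardEnclosure

open Real Set MeasureTheory Literature.MathematicalPhysics.QuantumLattice
open Summit.HubbardSuperconductivity.HubbardSuperconductivity.Theorems

/-! ## §1 Plumbing: `pt`, iterated integrals over closed intervals in both orders -/

/-- `y ↦ pt x y` is measurable. -/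
theorem measurable_pt_right (x : ℝ) : Measurable fun y : ℝ => pt x y := by
  have h1 : Measurable fun y : ℝ => (MeasurableEquiv.finTwoArrow (α := ℝ)).symm (x, y) :=
    (MeasurableEquiv.finTwoArrow (α := ℝ)).symm.measurable.comp (measurable_const.prodMk measurable_id)
  exact (MeasurableEquiv.toLp 2 (Fin 2 → ℝ)).measurable.comp h1

/-- `x ↦ pt x y` is measurable. -/
theorem measurable_pt_left (y : ℝ) : Measurable fun x : ℝ => pt x y := by
  have h1 : Measurable fun x : ℝ => (MeasurableEquiv.finTwoArrow (α := ℝ)).symm (x, y) :=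
    (MeasurableEquiv.finTwoArrow (α := ℝ)).symm.measurable.comp (measurable_id.prodMk measurable_const)
  exact (MeasurableEquiv.toLp 2 (Fin 2 → ℝ)).measurable.comp h1

/-- A point of the (half-open) cell has its coordinates in the closed coordinate intervals. -/
theorem Params.mem_Icc_of_mem_cellSet (P : Params) {a b c d : ℤ} {p : Momentum} (hp : p ∈ P.cellSet a b c d) :
    p 0 ∈ Icc ((a : ℝ) / (P.U : ℝ)) ((b : ℝ) / (P.U : ℝ)) ∧ p 1 ∈ Icc ((c : ℝ) / (P.U : ℝ)) ((d : ℝ) / (P.U : ℝ)) := by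
  simp only [Params.cellSet, mem_setOf_eq, P.cast_toQ] at hp
  exact ⟨⟨hp.1, hp.2.1.le⟩, ⟨hp.2.2.1, hp.2.2.2.le⟩⟩

/-- **SYMMETRIC ITERATED INTEGRAL** (ordinate outside): for `0 < U`, an oriented cell and `f` integrable on it,
`∫_{cell} f = ∫_{c/U}^{d/U} ∫_{a/U}^{b/U} f (pt x y) dx dy`. -/
theorem Params.setIntegral_cellSet_eq_iterated_symm (P : Params) (hU : 0 < P.U) {a b c d : ℤ} (hab : a ≤ b) (hcd : c ≤ d)
    (f : Momentum → ℝ) (hF : IntegrableOn f (P.cellSet a b c d) volume) :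
    ∫ p in P.cellSet a b c d, f p = ∫ y in ((c : ℝ) / (P.U : ℝ))..((d : ℝ) / (P.U : ℝ)),
      ∫ x in ((a : ℝ) / (P.U : ℝ))..((b : ℝ) / (P.U : ℝ)), f (pt x y) := by
  have hU' : (0 : ℝ) < (P.U : ℝ) := by exact_mod_cast hU
  set ra := ((P.toQ a : ℚ) : ℝ) with hra
  set rb := ((P.toQ b : ℚ) : ℝ) with hrb
  set rc := ((P.toQ c : ℚ) : ℝ) with hrc
  set rd := ((P.toQ d : ℚ) : ℝ) with hrd
  have era : ra = (a : ℝ) / (P.U : ℝ) := P.cast_toQ a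
  have erb : rb = (b : ℝ) / (P.U : ℝ) := P.cast_toQ b
  have erc : rc = (c : ℝ) / (P.U : ℝ) := P.cast_toQ c
  have erd : rd = (d : ℝ) / (P.U : ℝ) := P.cast_toQ d
  have hab' : ra ≤ rb := by rw [era, erb]; exact div_le_div_of_nonneg_right (by exact_mod_cast hab) hU'.le
  have hcd' : rc ≤ rd := by rw [erc, erd]; exact div_le_div_of_nonneg_right (by exact_mod_cast hcd) hU'.le
  set S : Set (Fin 2 → ℝ) := (MeasurableEquiv.finTwoArrow (α := ℝ)) ⁻¹' (Ico ra rb ×ˢ Ico rc rd) with hS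
  have hcell : P.cellSet a b c d = (WithLp.ofLp : Momentum → (Fin 2 → ℝ)) ⁻¹' S := by
    rw [P.cellSet_eq_preimage, P.box_eq_preimage_prod]
  set G : (Fin 2 → ℝ) → ℝ := fun v => f (WithLp.toLp 2 v) with hG
  have h1 : (∫ p in P.cellSet a b c d, f p) = ∫ v in S, G v := by
    rw [hcell]
    have := (PiLp.volume_preserving_ofLp (Fin 2)).setIntegral_preimage_emb
      (MeasurableEquiv.toLp 2 (Fin 2 → ℝ)).symm.measurableEmbedding G S
    simpa [hG] using this
  have hG_int : IntegrableOn G S volume := by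
    have := ((PiLp.volume_preserving_ofLp (Fin 2)).integrableOn_comp_preimage
      (MeasurableEquiv.toLp 2 (Fin 2 → ℝ)).symm.measurableEmbedding (f := G) (s := S)).mp
    apply this
    rw [← hcell]
    have e : G ∘ (WithLp.ofLp : Momentum → (Fin 2 → ℝ)) = f := by funext p; simp [hG]
    rw [e]; exact hF
  set H : ℝ × ℝ → ℝ := fun z => G ((MeasurableEquiv.finTwoArrow (α := ℝ)).symm z) with hH
  have hHG : ∀ v, H (MeasurableEquiv.finTwoArrow (α := ℝ) v) = G v := fun v => by
    simp only [hH, MeasurableEquiv.symm_apply_apply]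
  have h2 : (∫ v in S, G v) = ∫ z in Ico ra rb ×ˢ Ico rc rd, H z := by
    have key := (volume_preserving_finTwoArrow ℝ).setIntegral_preimage_emb
      (MeasurableEquiv.finTwoArrow (α := ℝ)).measurableEmbedding H (Ico ra rb ×ˢ Ico rc rd)
    simp_rw [hHG] at key
    rw [hS]; exact key
  have hH_int : IntegrableOn H (Ico ra rb ×ˢ Ico rc rd) (volume.prod volume) := by
    have := ((volume_preserving_finTwoArrow ℝ).integrableOn_comp_preimage
      (MeasurableEquiv.finTwoArrow (α := ℝ)).measurableEmbedding (f := H) (s := Ico ra rb ×ˢ Ico rc rd)).mp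
    have e : H ∘ (MeasurableEquiv.finTwoArrow (α := ℝ)) = G := funext hHG
    rw [e] at this
    exact this hG_int
  have h3 : (∫ z in Ico ra rb ×ˢ Ico rc rd, H z) = ∫ y in Ico rc rd, ∫ x in Ico ra rb, H (x, y) := by
    have hf' : Integrable H ((volume.restrict (Ico ra rb)).prod (volume.restrict (Ico rc rd))) := by
      rw [Measure.prod_restrict]; exact hH_int
    have := integral_prod_symm H hf'
    rw [Measure.prod_restrict] at this
    simpa [Measure.volume_eq_prod] using this
  have h4 : (∫ y in Ico rc rd, ∫ x in Ico ra rb, H (x, y)) = ∫ y in rc..rd, ∫ x in ra..rb, H (x, y) := by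
    rw [intervalIntegral.integral_of_le hcd', setIntegral_congr_set Ico_ae_eq_Ioc]
    congr 1; funext y
    rw [intervalIntegral.integral_of_le hab', setIntegral_congr_set Ico_ae_eq_Ioc]
  rw [h1, h2, h3, h4, era, erb, erc, erd]
  rfl

/-- The cell integral over CLOSED coordinate intervals, abscissa outside. -/
theorem Params.cellInt_eq_Icc_Icc (P : Params) (hU : 0 < P.U) {a b c d : ℤ} (hab : a ≤ b) (hcd : c ≤ d)
    (hF : IntegrableOn P.integrand (P.cellSet a b c d) volume) :
    P.cellInt a b c d = ∫ x in Icc ((a : ℝ) / (P.U : ℝ)) ((b : ℝ) / (P.U : ℝ)),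
      ∫ y in Icc ((c : ℝ) / (P.U : ℝ)) ((d : ℝ) / (P.U : ℝ)), P.integrand (pt x y) := by
  have hU' : (0 : ℝ) < (P.U : ℝ) := by exact_mod_cast hU
  have hab' : (a : ℝ) / (P.U : ℝ) ≤ (b : ℝ) / (P.U : ℝ) := div_le_div_of_nonneg_right (by exact_mod_cast hab) hU'.le
  have hcd' : (c : ℝ) / (P.U : ℝ) ≤ (d : ℝ) / (P.U : ℝ) := div_le_div_of_nonneg_right (by exact_mod_cast hcd) hU'.le
  rw [P.cellInt_eq_iterated hU hab hcd hF, intervalIntegral.integral_of_le hab', integral_Icc_eq_integral_Ioc]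
  have e : (fun x => ∫ y in ((c : ℝ) / (P.U : ℝ))..((d : ℝ) / (P.U : ℝ)), P.integrand (pt x y)) =
      fun x => ∫ y in Icc ((c : ℝ) / (P.U : ℝ)) ((d : ℝ) / (P.U : ℝ)), P.integrand (pt x y) := by
    funext x; rw [intervalIntegral.integral_of_le hcd', integral_Icc_eq_integral_Ioc]
  rw [e]

/-- The cell integral over CLOSED coordinate intervals, ordinate outside. -/
theorem Params.cellInt_eq_Icc_Icc_symm (P : Params) (hU : 0 < P.U) {a b c d : ℤ} (hab : a ≤ b) (hcd : c ≤ d)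
    (hF : IntegrableOn P.integrand (P.cellSet a b c d) volume) :
    P.cellInt a b c d = ∫ y in Icc ((c : ℝ) / (P.U : ℝ)) ((d : ℝ) / (P.U : ℝ)),
      ∫ x in Icc ((a : ℝ) / (P.U : ℝ)) ((b : ℝ) / (P.U : ℝ)), P.integrand (pt x y) := by
  have hU' : (0 : ℝ) < (P.U : ℝ) := by exact_mod_cast hU
  have hab' : (a : ℝ) / (P.U : ℝ) ≤ (b : ℝ) / (P.U : ℝ) := div_le_div_of_nonneg_right (by exact_mod_cast hab) hU'.le
  have hcd' : (c : ℝ) / (P.U : ℝ) ≤ (d : ℝ) / (P.U : ℝ) := div_le_div_of_nonneg_right (by exact_mod_cast hcd) hU'.le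
  unfold Params.cellInt
  rw [P.setIntegral_cellSet_eq_iterated_symm hU hab hcd P.integrand hF, intervalIntegral.integral_of_le hcd',
    integral_Icc_eq_integral_Ioc]
  have e : (fun y => ∫ x in ((a : ℝ) / (P.U : ℝ))..((b : ℝ) / (P.U : ℝ)), P.integrand (pt x y)) =
      fun y => ∫ x in Icc ((a : ℝ) / (P.U : ℝ)) ((b : ℝ) / (P.U : ℝ)), P.integrand (pt x y) := by
    funext y; rw [intervalIntegral.integral_of_le hab', integral_Icc_eq_integral_Ioc]
  rw [e]

/-! ## §2 Integer helpers -/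

/-- `cdivZ` of a non-negative numerator by a positive denominator is non-negative. -/
theorem cdivZ_nonneg {x y : ℤ} (hx : 0 ≤ x) (hy : 0 < y) : 0 ≤ cdivZ x y := by
  have h := div_le_cdivZ x y hy
  have h0 : (0 : ℚ) ≤ (x : ℚ) / (y : ℚ) := div_nonneg (by exact_mod_cast hx) (by exact_mod_cast hy.le)
  exact_mod_cast h0.trans h

/-- `0 < sDnZ a` certifies `sPos a` (the exact numerator is at least its floor quotient times `tpD`). -/
theorem Params.sPos_of_sDnZ_pos (P : Params) (htpD : 0 < P.tpD) {a : ℤ} (h : 0 < P.sDnZ a) : P.sPos a = true := by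
  simp only [Params.sPos, decide_eq_true_eq]
  simp only [Params.sDnZ, fdivZ] at h
  by_contra hneg
  push Not at hneg
  have := Int.ediv_le_ediv htpD (show 2 * D * P.tpD + 4 * P.tpN * a ≤ 0 from hneg)
  simp at this
  omega

/-! ## §3 The core theorem of the one-coordinate hyperbola rule -/

/-- **THE FINAL ROUNDING**: from the strip bound to the kernel's `vB`/`vA` numerator.  With `dz = b − a` grid units of outer width,
`τ/10⁴` the sine floor, `Smin/2^40`, `Vlo/2^40`, `LB/2^40`:
`2^30·[(dz/U)·(τ/10⁴)⁻¹·((Smin/2^40)⁻¹·log(1 + (Smin/2^40)(LB/2^40)/(Vlo/2^40)))] ≤ cdivZ (2^30·dz·10⁴·logUpZ (cdivZ (Smin·LB) Vlo)) (U·τ·Smin)`. -/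
theorem Params.hyperbola_rounding (P : Params) (hU : 0 < P.U) {dz Smin Vlo LB : ℤ} {τ : ℕ} (hdz : 0 ≤ dz) (hS : 0 < Smin)
    (hV : 0 < Vlo) (hLB : 0 ≤ LB) (hτ : 0 < τ) :
    2 ^ 30 * (((dz : ℝ) / (P.U : ℝ)) * ((((τ : ℝ) / 10 ^ 4))⁻¹ * (((((Smin : ℤ) : ℝ) / 2 ^ 40))⁻¹ *
      Real.log (1 + ((Smin : ℤ) : ℝ) / 2 ^ 40 * (((LB : ℤ) : ℝ) / 2 ^ 40) / (((Vlo : ℤ) : ℝ) / 2 ^ 40))))) ≤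
    ((cdivZ (2 ^ 30 * dz * 10 ^ 4 * logUpZ (cdivZ (Smin * LB) Vlo)) (P.U * (τ : ℤ) * Smin) : ℤ) : ℝ) := by
  have hU' : (0 : ℝ) < (P.U : ℝ) := by exact_mod_cast hU
  have hS' : (0 : ℝ) < ((Smin : ℤ) : ℝ) := by exact_mod_cast hS
  have hV' : (0 : ℝ) < ((Vlo : ℤ) : ℝ) := by exact_mod_cast hV
  have hτ' : (0 : ℝ) < (τ : ℝ) := by exact_mod_cast hτ
  have hdz' : (0 : ℝ) ≤ (dz : ℝ) := by exact_mod_cast hdz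
  -- the inner `cdivZ` and the log majorant
  set Z := cdivZ (Smin * LB) Vlo with hZ
  have hZ0 : 0 ≤ Z := cdivZ_nonneg (mul_nonneg hS.le hLB) hV
  have hZge : ((Smin : ℤ) : ℝ) * ((LB : ℤ) : ℝ) / ((Vlo : ℤ) : ℝ) ≤ ((Z : ℤ) : ℝ) := by
    have h := div_le_cdivZ (Smin * LB) Vlo hV
    have h' := (Rat.cast_le (K := ℝ)).mpr h
    push_cast at h'
    rw [hZ]; exact_mod_cast h'
  have hlog_le : Real.log (1 + ((Smin : ℤ) : ℝ) / 2 ^ 40 * (((LB : ℤ) : ℝ) / 2 ^ 40) / (((Vlo : ℤ) : ℝ) / 2 ^ 40))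
      ≤ ((logUpZ Z : ℤ) : ℝ) / 2 ^ 40 := by
    have h1 := le_logUpZ hZ0
    have e : ((Smin : ℤ) : ℝ) / 2 ^ 40 * (((LB : ℤ) : ℝ) / 2 ^ 40) / (((Vlo : ℤ) : ℝ) / 2 ^ 40)
        = (((Smin : ℤ) : ℝ) * ((LB : ℤ) : ℝ) / ((Vlo : ℤ) : ℝ)) / 2 ^ 40 := by
      field_simp
    rw [e, le_div_iff₀ (by positivity)]
    refine le_trans ?_ h1
    rw [mul_comm]
    apply mul_le_mul_of_nonneg_left _ (by positivity)
    apply Real.log_le_log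
    · have : 0 ≤ ((Smin : ℤ) : ℝ) * ((LB : ℤ) : ℝ) / ((Vlo : ℤ) : ℝ) := by
        have : (0 : ℝ) ≤ ((LB : ℤ) : ℝ) := by exact_mod_cast hLB
        positivity
      positivity
    · have := div_le_div_of_nonneg_right hZge (by positivity : (0 : ℝ) ≤ 2 ^ 40); linarith
  have hlog0 : 0 ≤ Real.log (1 + ((Smin : ℤ) : ℝ) / 2 ^ 40 * (((LB : ℤ) : ℝ) / 2 ^ 40) / (((Vlo : ℤ) : ℝ) / 2 ^ 40)) := by
    apply Real.log_nonneg
    have : (0 : ℝ) ≤ ((LB : ℤ) : ℝ) := by exact_mod_cast hLB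
    have : 0 ≤ ((Smin : ℤ) : ℝ) / 2 ^ 40 * (((LB : ℤ) : ℝ) / 2 ^ 40) / (((Vlo : ℤ) : ℝ) / 2 ^ 40) := by positivity
    linarith
  have hlogUp0 : (0 : ℝ) ≤ ((logUpZ Z : ℤ) : ℝ) := by
    have := hlog0.trans hlog_le
    have h2 : (0:ℝ) ≤ ((logUpZ Z : ℤ) : ℝ) / 2 ^ 40 := this
    rwa [le_div_iff₀ (by positivity), zero_mul] at h2
  -- the outer `cdivZ`
  have hden : 0 < P.U * (τ : ℤ) * Smin := by positivity
  have rc := div_le_cdivZ (2 ^ 30 * dz * 10 ^ 4 * logUpZ Z) (P.U * (τ : ℤ) * Smin) hden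
  have rc' := (Rat.cast_le (K := ℝ)).mpr rc
  simp only [Rat.cast_div, Rat.cast_intCast] at rc'
  refine le_trans ?_ rc'
  rw [le_div_iff₀ (by push_cast; positivity)]
  push_cast
  -- 2^30 · (dz/U) · (10⁴/τ) · (2^40/Smin) · log(…) · (U τ Smin) = 2^30 dz 10⁴ 2^40 log(…) ≤ 2^30 dz 10⁴ logUpZ
  have key : 2 ^ 30 * ((dz : ℝ) / (P.U : ℝ) * (((τ : ℝ) / 10 ^ 4)⁻¹ * ((((Smin : ℤ) : ℝ) / 2 ^ 40)⁻¹ *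
      Real.log (1 + ((Smin : ℤ) : ℝ) / 2 ^ 40 * (((LB : ℤ) : ℝ) / 2 ^ 40) / (((Vlo : ℤ) : ℝ) / 2 ^ 40))))) *
      ((P.U : ℝ) * (τ : ℝ) * ((Smin : ℤ) : ℝ))
      = 2 ^ 30 * (dz : ℝ) * 10 ^ 4 * (2 ^ 40 *
        Real.log (1 + ((Smin : ℤ) : ℝ) / 2 ^ 40 * (((LB : ℤ) : ℝ) / 2 ^ 40) / (((Vlo : ℤ) : ℝ) / 2 ^ 40))) := by
    field_simp
  rw [key]
  have h3 : 2 ^ 40 * Real.log (1 + ((Smin : ℤ) : ℝ) / 2 ^ 40 * (((LB : ℤ) : ℝ) / 2 ^ 40) / (((Vlo : ℤ) : ℝ) / 2 ^ 40))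
      ≤ ((logUpZ Z : ℤ) : ℝ) := by
    rw [le_div_iff₀ (by positivity)] at hlog_le; linarith
  have h4 : (0 : ℝ) ≤ 2 ^ 30 * (dz : ℝ) * 10 ^ 4 := by positivity
  linarith [mul_le_mul_of_nonneg_left h3 h4]

/-- **VARIANT B CORE** (substitute the ordinate).  On an oriented cell `a < b`, `c < d` inside the root square, suppose: (H1) at every point
of the closed cell the two-shell integrand is dominated by `cres (!far) (m x) (Smin/2^40) (Vlo/2^40) (cos (y + s))`; (H2) for
`y ∈ [c/U, d/U]`, `cos (y + s) ∈ [βLo, βUp]/2^40` and `τ/10⁴ ≤ |sin (y + s)|`; (H3) for `x ∈ [a/U, b/U]`,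
`cresExtentLE (!far) (m x) (βLo/2^40) (βUp/2^40) (LB/2^40)`; with `0 < Smin`, `0 < Vlo`, `0 ≤ LB`, `0 < τ`.  Then the kernel's `vB`
numerator is a certified ceiling: `CeilValid a b c d (cdivZ (2^30·(b−a)·10⁴·logUpZ (cdivZ (Smin·LB) Vlo)) (U·τ·Smin))`. -/
theorem Params.hyperbolaB_core (P : Params) (hP : P.admissible = true) {a b c d : ℤ} (hab : a < b) (hcd : c < d) (far : Bool)
    {Smin Vlo LB βLo βUp : ℤ} {τ : ℕ} {s : ℝ} {m : ℝ → ℝ} (hS : 0 < Smin) (hV : 0 < Vlo) (hLB : 0 ≤ LB) (hτ : 0 < τ)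
    (H1 : ∀ x ∈ Icc ((a : ℝ) / (P.U : ℝ)) ((b : ℝ) / (P.U : ℝ)), ∀ y ∈ Icc ((c : ℝ) / (P.U : ℝ)) ((d : ℝ) / (P.U : ℝ)),
      P.integrand (pt x y) ≤ cres (!far) (m x) (((Smin : ℤ) : ℝ) / 2 ^ 40) (((Vlo : ℤ) : ℝ) / 2 ^ 40) (Real.cos (y + s)))
    (H2 : ∀ y ∈ Icc ((c : ℝ) / (P.U : ℝ)) ((d : ℝ) / (P.U : ℝ)),
      (((βLo : ℤ) : ℝ) / 2 ^ 40 ≤ Real.cos (y + s) ∧ Real.cos (y + s) ≤ ((βUp : ℤ) : ℝ) / 2 ^ 40) ∧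
        (τ : ℝ) / 10 ^ 4 ≤ |Real.sin (y + s)|)
    (H3 : ∀ x ∈ Icc ((a : ℝ) / (P.U : ℝ)) ((b : ℝ) / (P.U : ℝ)),
      cresExtentLE (!far) (m x) (((βLo : ℤ) : ℝ) / 2 ^ 40) (((βUp : ℤ) : ℝ) / 2 ^ 40) (((LB : ℤ) : ℝ) / 2 ^ 40)) :
    P.CeilValid a b c d (cdivZ (2 ^ 30 * (b - a) * 10 ^ 4 * logUpZ (cdivZ (Smin * LB) Vlo)) (P.U * (τ : ℤ) * Smin)) := by
  obtain ⟨htpD, hmuD, hU, -, -⟩ := P.admissible_facts hP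
  have hU' : (0 : ℝ) < (P.U : ℝ) := by exact_mod_cast hU
  have hS' : (0 : ℝ) < ((Smin : ℤ) : ℝ) / 2 ^ 40 := div_pos (by exact_mod_cast hS) (by positivity)
  have hV' : (0 : ℝ) < ((Vlo : ℤ) : ℝ) / 2 ^ 40 := div_pos (by exact_mod_cast hV) (by positivity)
  have hL' : (0 : ℝ) ≤ ((LB : ℤ) : ℝ) / 2 ^ 40 := div_nonneg (by exact_mod_cast hLB) (by positivity)
  have hτ' : (0 : ℝ) < (τ : ℝ) / 10 ^ 4 := div_pos (by exact_mod_cast hτ) (by positivity)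
  have hx01 : (a : ℝ) / (P.U : ℝ) ≤ (b : ℝ) / (P.U : ℝ) := div_le_div_of_nonneg_right (by exact_mod_cast hab.le) hU'.le
  have hy01 : (c : ℝ) / (P.U : ℝ) ≤ (d : ℝ) / (P.U : ℝ) := div_le_div_of_nonneg_right (by exact_mod_cast hcd.le) hU'.le
  -- integrability on the cell: F ≤ cres ≤ 1/V
  have hbd : ∀ p ∈ P.cellSet a b c d, ‖P.integrand p‖ ≤ 1 / (((Vlo : ℤ) : ℝ) / 2 ^ 40) := by
    intro p hp
    obtain ⟨h0, h1⟩ := P.mem_Icc_of_mem_cellSet hp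
    have hpt : pt (p 0) (p 1) = p := by
      ext i; fin_cases i
      · exact pt_apply_zero _ _
      · exact pt_apply_one _ _
    rw [Real.norm_of_nonneg (P.integrand_nonneg p), ← hpt]
    exact (H1 _ h0 _ h1).trans (cres_bounds (!far) hS'.le hV' _).2
  have hint : IntegrableOn P.integrand (P.cellSet a b c d) volume :=
    Measure.integrableOn_of_bounded (P.volume_cellSet_lt_top a b c d).ne P.measurable_integrand.aestronglyMeasurable
      (ae_restrict_of_forall_mem (P.measurableSet_cellSet a b c d) hbd)
  refine ⟨hint, ?_⟩
  rw [P.cellInt_eq_Icc_Icc hU hab.le hcd.le hint]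
  -- the strip lemma
  have hinj : InjOn Real.cos (Icc ((c : ℝ) / (P.U : ℝ) + s) ((d : ℝ) / (P.U : ℝ) + s)) := by
    apply injOn_cos_of_sin_ne_zero
    intro y hy
    have h := (H2 (y - s) ⟨by linarith [hy.1], by linarith [hy.2]⟩).2
    rw [sub_add_cancel] at h
    intro h0; rw [h0, abs_zero] at h; linarith
  have hFi : ∀ x ∈ Icc ((a : ℝ) / (P.U : ℝ)) ((b : ℝ) / (P.U : ℝ)),
      IntegrableOn (fun y => P.integrand (pt x y)) (Icc ((c : ℝ) / (P.U : ℝ)) ((d : ℝ) / (P.U : ℝ))) volume := by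
    intro x hx
    exact Measure.integrableOn_of_bounded (measure_Icc_lt_top (a := (c : ℝ) / (P.U : ℝ)) (b := (d : ℝ) / (P.U : ℝ))).ne
      (P.measurable_integrand.comp (measurable_pt_right x)).aestronglyMeasurable
      (ae_restrict_of_forall_mem measurableSet_Icc fun y hy => by
        rw [Real.norm_of_nonneg (P.integrand_nonneg _)]
        exact (H1 x hx y hy).trans (cres_bounds (!far) hS'.le hV' _).2)
  have strip := strip_lemma (!far) (F := fun x y => P.integrand (pt x y)) hx01 hy01 hτ' hS' hV' hL'
    (fun y hy => (H2 y hy).2) (fun y hy => (H2 y hy).1) hinj H3 (fun x _ y _ => P.integrand_nonneg _) hFi H1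
  -- rounding
  have hround := P.hyperbola_rounding hU (dz := b - a) (sub_nonneg.mpr hab.le) hS hV hLB hτ
  have hw : (b : ℝ) / (P.U : ℝ) - (a : ℝ) / (P.U : ℝ) = ((b - a : ℤ) : ℝ) / (P.U : ℝ) := by push_cast; ring
  rw [hw] at strip
  calc 2 ^ 30 * ∫ x in Icc ((a : ℝ) / (P.U : ℝ)) ((b : ℝ) / (P.U : ℝ)), ∫ y in Icc ((c : ℝ) / (P.U : ℝ)) ((d : ℝ) / (P.U : ℝ)),
        P.integrand (pt x y)
      ≤ 2 ^ 30 * ((((b - a : ℤ) : ℝ) / (P.U : ℝ)) * ((((τ : ℝ) / 10 ^ 4))⁻¹ * (((((Smin : ℤ) : ℝ) / 2 ^ 40))⁻¹ *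
          Real.log (1 + ((Smin : ℤ) : ℝ) / 2 ^ 40 * (((LB : ℤ) : ℝ) / 2 ^ 40) / (((Vlo : ℤ) : ℝ) / 2 ^ 40))))) :=
        mul_le_mul_of_nonneg_left strip (by positivity)
    _ ≤ _ := by exact_mod_cast hround

/-- **VARIANT A CORE** (substitute the abscissa): the mirror image of `hyperbolaB_core` with the crescent majorant in the cosine of the
(possibly shifted) ABSCISSA, the crescent position depending on the ordinate, and the outer width `d − c`. -/
theorem Params.hyperbolaA_core (P : Params) (hP : P.admissible = true) {a b c d : ℤ} (hab : a < b) (hcd : c < d) (far : Bool)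
    {Smin Vlo LA αLo αUp : ℤ} {τ : ℕ} {s : ℝ} {m : ℝ → ℝ} (hS : 0 < Smin) (hV : 0 < Vlo) (hLA : 0 ≤ LA) (hτ : 0 < τ)
    (H1 : ∀ x ∈ Icc ((a : ℝ) / (P.U : ℝ)) ((b : ℝ) / (P.U : ℝ)), ∀ y ∈ Icc ((c : ℝ) / (P.U : ℝ)) ((d : ℝ) / (P.U : ℝ)),
      P.integrand (pt x y) ≤ cres (!far) (m y) (((Smin : ℤ) : ℝ) / 2 ^ 40) (((Vlo : ℤ) : ℝ) / 2 ^ 40) (Real.cos (x + s)))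
    (H2 : ∀ x ∈ Icc ((a : ℝ) / (P.U : ℝ)) ((b : ℝ) / (P.U : ℝ)),
      (((αLo : ℤ) : ℝ) / 2 ^ 40 ≤ Real.cos (x + s) ∧ Real.cos (x + s) ≤ ((αUp : ℤ) : ℝ) / 2 ^ 40) ∧
        (τ : ℝ) / 10 ^ 4 ≤ |Real.sin (x + s)|)
    (H3 : ∀ y ∈ Icc ((c : ℝ) / (P.U : ℝ)) ((d : ℝ) / (P.U : ℝ)),
      cresExtentLE (!far) (m y) (((αLo : ℤ) : ℝ) / 2 ^ 40) (((αUp : ℤ) : ℝ) / 2 ^ 40) (((LA : ℤ) : ℝ) / 2 ^ 40)) :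
    P.CeilValid a b c d (cdivZ (2 ^ 30 * (d - c) * 10 ^ 4 * logUpZ (cdivZ (Smin * LA) Vlo)) (P.U * (τ : ℤ) * Smin)) := by
  obtain ⟨htpD, hmuD, hU, -, -⟩ := P.admissible_facts hP
  have hU' : (0 : ℝ) < (P.U : ℝ) := by exact_mod_cast hU
  have hS' : (0 : ℝ) < ((Smin : ℤ) : ℝ) / 2 ^ 40 := div_pos (by exact_mod_cast hS) (by positivity)
  have hV' : (0 : ℝ) < ((Vlo : ℤ) : ℝ) / 2 ^ 40 := div_pos (by exact_mod_cast hV) (by positivity)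
  have hL' : (0 : ℝ) ≤ ((LA : ℤ) : ℝ) / 2 ^ 40 := div_nonneg (by exact_mod_cast hLA) (by positivity)
  have hτ' : (0 : ℝ) < (τ : ℝ) / 10 ^ 4 := div_pos (by exact_mod_cast hτ) (by positivity)
  have hx01 : (a : ℝ) / (P.U : ℝ) ≤ (b : ℝ) / (P.U : ℝ) := div_le_div_of_nonneg_right (by exact_mod_cast hab.le) hU'.le
  have hy01 : (c : ℝ) / (P.U : ℝ) ≤ (d : ℝ) / (P.U : ℝ) := div_le_div_of_nonneg_right (by exact_mod_cast hcd.le) hU'.le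
  have hbd : ∀ p ∈ P.cellSet a b c d, ‖P.integrand p‖ ≤ 1 / (((Vlo : ℤ) : ℝ) / 2 ^ 40) := by
    intro p hp
    obtain ⟨h0, h1⟩ := P.mem_Icc_of_mem_cellSet hp
    have hpt : pt (p 0) (p 1) = p := by
      ext i; fin_cases i
      · exact pt_apply_zero _ _
      · exact pt_apply_one _ _
    rw [Real.norm_of_nonneg (P.integrand_nonneg p), ← hpt]
    exact (H1 _ h0 _ h1).trans (cres_bounds (!far) hS'.le hV' _).2
  have hint : IntegrableOn P.integrand (P.cellSet a b c d) volume :=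
    Measure.integrableOn_of_bounded (P.volume_cellSet_lt_top a b c d).ne P.measurable_integrand.aestronglyMeasurable
      (ae_restrict_of_forall_mem (P.measurableSet_cellSet a b c d) hbd)
  refine ⟨hint, ?_⟩
  rw [P.cellInt_eq_Icc_Icc_symm hU hab.le hcd.le hint]
  have hinj : InjOn Real.cos (Icc ((a : ℝ) / (P.U : ℝ) + s) ((b : ℝ) / (P.U : ℝ) + s)) := by
    apply injOn_cos_of_sin_ne_zero
    intro x hx
    have h := (H2 (x - s) ⟨by linarith [hx.1], by linarith [hx.2]⟩).2
    rw [sub_add_cancel] at h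
    intro h0; rw [h0, abs_zero] at h; linarith
  have hFi : ∀ y ∈ Icc ((c : ℝ) / (P.U : ℝ)) ((d : ℝ) / (P.U : ℝ)),
      IntegrableOn (fun x => P.integrand (pt x y)) (Icc ((a : ℝ) / (P.U : ℝ)) ((b : ℝ) / (P.U : ℝ))) volume := by
    intro y hy
    exact Measure.integrableOn_of_bounded (measure_Icc_lt_top (a := (a : ℝ) / (P.U : ℝ)) (b := (b : ℝ) / (P.U : ℝ))).ne
      (P.measurable_integrand.comp (measurable_pt_left y)).aestronglyMeasurable
      (ae_restrict_of_forall_mem measurableSet_Icc fun x hx => by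
        rw [Real.norm_of_nonneg (P.integrand_nonneg _)]
        exact (H1 x hx y hy).trans (cres_bounds (!far) hS'.le hV' _).2)
  have strip := strip_lemma (!far) (F := fun y x => P.integrand (pt x y)) hy01 hx01 hτ' hS' hV' hL'
    (fun x hx => (H2 x hx).2) (fun x hx => (H2 x hx).1) hinj H3 (fun y _ x _ => P.integrand_nonneg _) hFi
    (fun y hy x hx => H1 x hx y hy)
  have hround := P.hyperbola_rounding hU (dz := d - c) (sub_nonneg.mpr hcd.le) hS hV hLA hτ
  have hw : (d : ℝ) / (P.U : ℝ) - (c : ℝ) / (P.U : ℝ) = ((d - c : ℤ) : ℝ) / (P.U : ℝ) := by push_cast; ring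
  rw [hw] at strip
  calc 2 ^ 30 * ∫ y in Icc ((c : ℝ) / (P.U : ℝ)) ((d : ℝ) / (P.U : ℝ)), ∫ x in Icc ((a : ℝ) / (P.U : ℝ)) ((b : ℝ) / (P.U : ℝ)),
        P.integrand (pt x y)
      ≤ 2 ^ 30 * ((((d - c : ℤ) : ℝ) / (P.U : ℝ)) * ((((τ : ℝ) / 10 ^ 4))⁻¹ * (((((Smin : ℤ) : ℝ) / 2 ^ 40))⁻¹ *
          Real.log (1 + ((Smin : ℤ) : ℝ) / 2 ^ 40 * (((LA : ℤ) : ℝ) / 2 ^ 40) / (((Vlo : ℤ) : ℝ) / 2 ^ 40))))) :=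
        mul_le_mul_of_nonneg_left strip (by positivity)
    _ ≤ _ := by exact_mod_cast hround

end Summit.HubbardSuperconductivity.HubbardSuperconductivity.Theorems.KlLindhardEnclosure

end
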